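import Summits.QuantumFields.YangMills.Theorems.FluctuationComparisonRegPrIntLS2BetaSmoothResidualCopy
import Summits.QuantumFields.YangMills.Theorems.FluctuationComparisonRegPrIntLS2BetaAveragedBondWord
import HarnessLib

/-!
# S2β · GAP♯∘ — (RES-u.7σ-β) «THE COARSE GRADIENT OF `g↓` FROM THE (BKG) BINDER»: the (BKG) plaquette binder is GAUGE-INVARIANT, so px20 g25's averaged-bond word
# bound (✓p840154) applies to the re-gauged fine field `g•U₀`, and ✓p840122 §6 turns it into the `hgrad` input of (RES-u.7)'s Lipschitz lift at `t := g↓`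

Cell `ym3-torus` (rung R3 = continuum `SU(2)` YM₃ on T³ at fixed lattice data — NOT d = 4, NOT infinite volume, NOT a mass gap, NOT Clay).  Width seat
`ym-ust-20520-w5` (gen 29), explicit-unit helper on crux `stmt-QuantumFields-20520`, LINE g18-1 S2β (registry untouched), organ GAP♯∘, node (RES-u) (desk RULING №131
(RES-u.7σ); architect px17 g23 2026-09-01T02:05Z (3): «the unit gradient of `g↓` obeys `dist1 (g↓x·(g↓y)⁻¹) ≤ c_d·s₀ + dist1 (V B)`»).  By name:
`hgrad` for `g↓` ⟸ ✓p840122 `bondGrad_descTransf_le_of_descent` (needs `dist1 ((g•U₀)↓ B) ≤ s′`) ⟸ ✓p840154 `dist1_descendTo_le_bkg` at the field `g•U₀` (needs its fine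
bonds `≤ s` — the small-bond gauge letter at level `K` — and the (BKG) plaquette binder FOR `g•U₀`) ⟸ §1: (BKG) for `g•U₀` ⟺ (BKG) for `U₀` (covariance of the iterated averaging,
lit ✓`iter_gaugeAct`, conjugation of plaquette variables, lit ✓`plaqHol_gaugeAct`, invariance of `dist1`).
* §1 ★`bkg_gaugeAct_iff` (the (BKG) binder text of ✓p840154, `g•U₀` vs `U₀`; the one-plaquette identity is the tree's `dist1_plaqHol_iter_gaugeAct`, inlined).
* §2 ★★`bondGrad_descTransf_le_of_bkg` — `∀ B, dist1 (g↓ B₊·(g↓ B₋)⁻¹) ≤ (L^{K−J}·s + ((3+2)²L∕(2(L−1)))·(C_B·α)) + σ_V` from {`hg` (fine bonds of `g•U₀`), (BKG) for `U₀`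
  VERBATIM as in ✓p840154, its two window clauses, `hσV` (the datum in its √θ-gauge)} — (RES-u.7)'s `hgrad` at `t := descTransf g`, `tgt·src⁻¹`; with `s = η·s₀`
  (`hBG` read at level `K`) the first term is `s₀ = O(window)`.
* §3 `bondGrad_descTransf_le_of_bkg_of_arc` — the same from the ARC letter `‖logVec (su2Quat ((g•U₀) e))‖ ≤ s` (chord ≤ arc, ✓`dist1_le_norm_logVec`).
`--kind proof --supports stmt-QuantumFields-20520 --as helper`, DEFINITION-FREE (0 `def`, 0 `instance`, 0 `sorry`; default heartbeats).

HONEST.  Composition by name over landed letters; `hg`∕`hgArc` (= `hBG` at level `K`, a CONJECTURE's instance), `hBKG` (the lane's (BKG) binder), `hσV` are HYPOTHESES; nothing of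
Bałaban's analysis is asserted or proved ([Balaban1985Averaging] (8) p.18, (11)–(13) p.19: covariance of the averaging under gauge transformations; [Balaban1987RG1] (0.4)
p.253); GAP♯∘ (`stub_uniformFibreGapOrbit`, 0∕5), the five REGISTERED stubs, S2β, crux 20520, 19936, 19200, `YM3TorusSU2` NOT proved; no summit statement is proved by a
helper; rung R3 = SU(2) YM₃ on T³ — NOT d = 4, NOT infinite volume, NOT a mass gap, NOT Clay; the Yang–Mills mass gap is NOT proved.
-/

set_option autoImplicit false

noncomputable section

namespace Summit.QuantumFields.YangMills.Theorems.FluctuationComparisonRegPrIntLS2BetaCoarseGradientOfBkg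

open Literature.MathematicalPhysics.QuantumLattice (su2Quat)
open Literature.MathematicalPhysics.QuantumFieldTheory.Balaban1983to89
open T4Continuum T3ContinuumYM3Torus T3UnitScaleTilt T3TiltDescent T3LevelShift
open T3UnitLawDensityEML (ℰp)
open T3ConstrainedMinimiser (fibre)
open T3PrintedRegularOrbits (descTransf)
open T4ExpWindowSmallField (logVec)
open ExpMeanLog (deltaSU)
open Summit.QuantumFields.YangMills.Theorems.FluctuationComparisonRegPrIntLS2BetaGeodesicJensenLift (dist1_le_norm_logVec)
open Summit.QuantumFields.YangMills.Theorems.FluctuationComparisonRegPrIntLS2BetaSmoothResidualCopy (bondGrad_descTransf_le_of_descent)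
open Summit.QuantumFields.YangMills.Theorems.FluctuationComparisonRegPrIntLS2BetaAveragedBondWord (dist1_descendTo_le_bkg)

/-! ## §1 The (BKG) plaquette binder is gauge-invariant -/

section BkgT3

variable (F : T3Family) {J K : ℕ}

/-- **THE (BKG) BINDER IS GAUGE-INVARIANT** (✓p840154's binder text, for `g•U₀` iff for `U₀`). [cite: Balaban1985Averaging, (11)-(13) p.19] -/
theorem bkg_gaugeAct_iff (g : Site (F.P K) 0 → Matrix.specialUnitaryGroup (Fin 2) ℂ) (U₀ : GaugeField (F.P K) 0 (Matrix.specialUnitaryGroup (Fin 2) ℂ))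
    (C_B α : ℝ) :
    (∀ t, t ≤ K - J → ∀ p : Plaq (F.P K) t,
        dist1 (GaugeField.plaqHol (Averaging.iter (fun k => BlockAveraging.blockAvg (P := F.P K) (j := k) ℰp) t (GaugeField.gaugeAct g U₀)) p) ≤
          C_B * α * (F.L : ℝ) ^ (2 * t) * ((F.L : ℝ)⁻¹) ^ (2 * (K - J))) ↔
      (∀ t, t ≤ K - J → ∀ p : Plaq (F.P K) t,
        dist1 (GaugeField.plaqHol (Averaging.iter (fun k => BlockAveraging.blockAvg (P := F.P K) (j := k) ℰp) t U₀) p) ≤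
          C_B * α * (F.L : ℝ) ^ (2 * t) * ((F.L : ℝ)⁻¹) ^ (2 * (K - J))) := by
  refine forall_congr' fun t => forall_congr' fun ht => forall_congr' fun p => ?_
  -- `avg^t (g•U₀) = g^{(t)}•avg^t U₀` (lit ✓`iter_gaugeAct`), plaquettes conjugate (lit ✓`plaqHol_gaugeAct`), `dist1` is conjugation-invariant
  -- (the tree's `dist1_plaqHol_iter_gaugeAct` of ✓`UnitScaleGibbsDressedEventSplit`, inlined to keep the imports light)
  rw [iter_gaugeAct _ g t (by show t ≤ F.m + K; omega) U₀, T4WilsonGaugeFlatDirection.plaqHol_gaugeAct, GaugeGroup.dist1_conj]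

end BkgT3

/-! ## §2 (RES-u.7)'s `hgrad` at `t := g↓` from the (BKG) binder -/

section Grad

variable (F : T3Family) {J K : ℕ} (hJK : J ≤ K)

/-- ★★ **THE COARSE GRADIENT OF `g↓` FROM THE (BKG) BINDER**: fine bonds of `g•U₀` `≤ s`, the (BKG) plaquette binder for `U₀` (✓p840154's text) with its two window clauses,
`U₀` over `V` and `dist1 (V B) ≤ σ_V` ⟹ `dist1 (g↓ B₊·(g↓ B₋)⁻¹) ≤ (L^{K−J}·s + ((3+2)²L∕(2(L−1)))·(C_B·α)) + σ_V` on every coarse bond — the `hgrad` input of (RES-u.7)'s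
Lipschitz lift at `t := descTransf g` (✓`bondGrad_descTransf_le_of_descent` ∘ ✓`dist1_descendTo_le_bkg` at `g•U₀` ∘ §1). [cite: Balaban1985Averaging, (8) p.18, (11)-(13) p.19; Balaban1987RG1, (0.4) p.253] -/
theorem bondGrad_descTransf_le_of_bkg {g : Site (F.P K) 0 → Matrix.specialUnitaryGroup (Fin 2) ℂ}
    {U₀ : GaugeField (F.P K) 0 (Matrix.specialUnitaryGroup (Fin 2) ℂ)} {V : GaugeField (F.P J) 0 (Matrix.specialUnitaryGroup (Fin 2) ℂ)}
    {s C_B α σV : ℝ} (hU₀ : U₀ ∈ fibre F ℰp J K hJK V)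
    (hg : ∀ ℓ : PBond (F.P K) 0, dist1 (GaugeField.gaugeAct g U₀ ℓ) ≤ s) (hCB : 0 ≤ C_B) (hα : 0 ≤ α)
    (hBKG : ∀ t, t ≤ K - J → ∀ p : Plaq (F.P K) t,
      dist1 (GaugeField.plaqHol (Averaging.iter (fun k => BlockAveraging.blockAvg (P := F.P K) (j := k) ℰp) t U₀) p) ≤
        C_B * α * (F.L : ℝ) ^ (2 * t) * ((F.L : ℝ)⁻¹) ^ (2 * (K - J)))
    (hδ : ((((3 + 2) * F.L : ℕ) : ℝ) ^ 2 / 4) * (C_B * α) < deltaSU (Fin 2))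
    (h6 : ((((3 + 2) * F.L : ℕ) : ℝ) ^ 2 / 4) * (C_B * α) ≤ 1 / 6)
    (hσV : ∀ B : PBond (F.P J) 0, dist1 (V B) ≤ σV) :
    ∀ B : PBond (F.P J) 0, dist1 (descTransf F J K hJK g B.tgt * (descTransf F J K hJK g B.src)⁻¹) ≤
      ((F.L : ℝ) ^ (K - J) * s + ((3 + 2) ^ 2 * (F.L : ℝ) / (2 * ((F.L : ℝ) - 1))) * (C_B * α)) + σV :=
  bondGrad_descTransf_le_of_descent F hJK hU₀
    (fun B => dist1_descendTo_le_bkg F hJK (GaugeField.gaugeAct g U₀) hg hCB hα ((bkg_gaugeAct_iff F g U₀ C_B α).mpr hBKG) hδ h6 B) hσV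

/-! ## §3 ARC edition -/

/-- The same from the ARC letter `‖logVec (su2Quat ((g•U₀) e))‖ ≤ s` (= the small-bond gauge letter `hBG` read at level `K`; chord ≤ arc, ✓`dist1_le_norm_logVec`).
[cite: Balaban1985Averaging, (8) p.18, (11)-(13) p.19] -/
theorem bondGrad_descTransf_le_of_bkg_of_arc {g : Site (F.P K) 0 → Matrix.specialUnitaryGroup (Fin 2) ℂ}
    {U₀ : GaugeField (F.P K) 0 (Matrix.specialUnitaryGroup (Fin 2) ℂ)} {V : GaugeField (F.P J) 0 (Matrix.specialUnitaryGroup (Fin 2) ℂ)}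
    {s C_B α σV : ℝ} (hU₀ : U₀ ∈ fibre F ℰp J K hJK V)
    (hgArc : ∀ e : PBond (F.P K) 0, ‖logVec (su2Quat (GaugeField.gaugeAct g U₀ e))‖ ≤ s) (hCB : 0 ≤ C_B) (hα : 0 ≤ α)
    (hBKG : ∀ t, t ≤ K - J → ∀ p : Plaq (F.P K) t,
      dist1 (GaugeField.plaqHol (Averaging.iter (fun k => BlockAveraging.blockAvg (P := F.P K) (j := k) ℰp) t U₀) p) ≤
        C_B * α * (F.L : ℝ) ^ (2 * t) * ((F.L : ℝ)⁻¹) ^ (2 * (K - J)))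
    (hδ : ((((3 + 2) * F.L : ℕ) : ℝ) ^ 2 / 4) * (C_B * α) < deltaSU (Fin 2))
    (h6 : ((((3 + 2) * F.L : ℕ) : ℝ) ^ 2 / 4) * (C_B * α) ≤ 1 / 6)
    (hσV : ∀ B : PBond (F.P J) 0, dist1 (V B) ≤ σV) :
    ∀ B : PBond (F.P J) 0, dist1 (descTransf F J K hJK g B.tgt * (descTransf F J K hJK g B.src)⁻¹) ≤
      ((F.L : ℝ) ^ (K - J) * s + ((3 + 2) ^ 2 * (F.L : ℝ) / (2 * ((F.L : ℝ) - 1))) * (C_B * α)) + σV :=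
  bondGrad_descTransf_le_of_bkg F hJK hU₀ (fun e => (dist1_le_norm_logVec _).trans (hgArc e)) hCB hα hBKG hδ h6 hσV

end Grad

end Summit.QuantumFields.YangMills.Theorems.FluctuationComparisonRegPrIntLS2BetaCoarseGradientOfBkg

end
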